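import Summits.CriticalPhenomena.PercolationContinuityZ3.Theorems.PercNearOneGluingNoHeavyLowerTailOneCutFourBlobs
import HarnessLib

/-!
# The one-cut bound for four blobs holds with constant `3/2`, unconditionally

Support file for the crux `NoHeavyLowerTail` (stmt-CriticalPhenomena-4575; routes `PercNearOneGluing`,
`PercNearOneGluingNoHeavy`), BLOB-QUOTIENT analysis of the one-cut engine (depth prover nh-dp-blobmono),
continuing `…OneCutThreeBlobs.lean` (≤ 3 blobs, constant 1) and `…OneCutFourBlobs.lean` (4 blobs:
observer-free case and heavy-blob case, constant 1).

Setting as there: `μ = prodBernoulli w` on `Fin n`, relays `A`, observer `o`,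
`N = |{a ∈ A : o ↔ a}|`, `E N = Σ_{a∈A} μ(o ↔ a)`, minority event `B = {1 ≤ N < E N/2}`, a blob structure
`cls : Fin n → Fin 4` on `insert o A` (same label ⇒ joined almost surely), masses `m_i = |A ∩ cls⁻¹ i|`.

MAIN RESULT (`oneCut_of_fourBlobs_threeHalves`): for EVERY four-blob structure, every `|A|` and every
weight, `μ(B) ≤ (3/2)·t` whenever all pairwise disconnection probabilities among distinct relays are `≤ t`.
So four-blob structures satisfy the LINEAR one-cut form with constant `3/2` — enough for the crux, whose
reduction `Theorems.noHeavyLowerTail_of_oneCut` tolerates any constant after rescaling `δ` — and can never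
refute `NoHeavyLowerTail`; only the sharp constant `1` of the registered stub `stub_oneCut` is open on them.

Proof.  By `…OneCutFourBlobs.lean` the bound with constant `1` holds unless the observer's blob carries a
relay `x₀` and every other blob is light (`m_{cls o} + m_j < E N/2`).  In that residual regime every PAIR
of other blobs is heavy (else the third blob alone would be heavy), so on the good set `o` reaches at most
one of the three representatives `a, b, c`, i.e. `B ⊆ {x₀ misses at least two of a, b, c}` up to a null
set (`x₀ ↔ o` a.s.); and for any three events `2·μ(at least two of them) ≤ μD_a + μD_b + μD_c`
(`measureReal_twoOfThree_le`, layer-cake), each `μ{x₀ ↮ ·} ≤ t`.  The sharp constant `1` in this regime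
is exactly the four-terminal inequality (R4a*) recorded in `…OneCutFourBlobs.lean`.
-/

noncomputable section

namespace Summit.CriticalPhenomena.PercolationContinuityZ3.Theorems

open MeasureTheory Set Literature.Probability.LatticeModels Literature.Probability.Percolation
open scoped Classical BigOperators

variable {n : ℕ}

/-- Layer-cake for three events: twice the mass of "at least two of `D_a, D_b, D_c`" is at most
`μD_a + μD_b + μD_c`. [folklore] -/
theorem measureReal_twoOfThree_le (w : Sym2 (Fin n) → unitInterval) (Da Db Dc : Set (BondConfig (Fin n))) :
    2 * (prodBernoulli w).real ((Da ∩ Db) ∪ (Da ∩ Dc) ∪ (Db ∩ Dc)) ≤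
      (prodBernoulli w).real Da + (prodBernoulli w).real Db + (prodBernoulli w).real Dc := by
  set μ := prodBernoulli w with hμ
  set U := ((Da ∩ Db) ∪ (Da ∩ Dc) ∪ (Db ∩ Dc) : Set (BondConfig (Fin n))) with hU
  -- the three "exactly two" pieces
  set Ta := (Db ∩ Dc ∩ Daᶜ : Set (BondConfig (Fin n))) with hTa
  set Tb := (Da ∩ Dc ∩ Dbᶜ : Set (BondConfig (Fin n))) with hTb
  set Tc := (Da ∩ Db ∩ Dcᶜ : Set (BondConfig (Fin n))) with hTc
  have h1 : μ.real U ≤ μ.real Da + μ.real Ta :=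
    calc μ.real U ≤ μ.real (Da ∪ Ta) := measureReal_mono fun ω hω => by
            simp only [hU, hTa, mem_union, mem_inter_iff, mem_compl_iff] at hω ⊢
            tauto
      _ ≤ μ.real Da + μ.real Ta := measureReal_union_le _ _
  have h2 : μ.real U ≤ μ.real Db + μ.real Tb :=
    calc μ.real U ≤ μ.real (Db ∪ Tb) := measureReal_mono fun ω hω => by
            simp only [hU, hTb, mem_union, mem_inter_iff, mem_compl_iff] at hω ⊢
            tauto
      _ ≤ μ.real Db + μ.real Tb := measureReal_union_le _ _
  have h3 : μ.real U ≤ μ.real Dc + μ.real Tc :=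
    calc μ.real U ≤ μ.real (Dc ∪ Tc) := measureReal_mono fun ω hω => by
            simp only [hU, hTc, mem_union, mem_inter_iff, mem_compl_iff] at hω ⊢
            tauto
      _ ≤ μ.real Dc + μ.real Tc := measureReal_union_le _ _
  have dab : Disjoint Ta Tb := Set.disjoint_left.2 fun ω h1 h2 => by
    simp only [hTa, hTb, mem_inter_iff, mem_compl_iff] at h1 h2
    exact h1.2 h2.1.1
  have dabc : Disjoint (Ta ∪ Tb) Tc := Set.disjoint_left.2 fun ω h1 h2 => by
    simp only [hTa, hTb, hTc, mem_union, mem_inter_iff, mem_compl_iff] at h1 h2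
    rcases h1 with h1 | h1
    · exact h1.2 h2.1.1
    · exact h1.2 h2.1.2
  have h4 : μ.real Ta + μ.real Tb + μ.real Tc ≤ μ.real U := by
    rw [← measureReal_union dab MeasurableSet.of_discrete,
      ← measureReal_union dabc MeasurableSet.of_discrete]
    exact measureReal_mono fun ω hω => by
      simp only [hU, hTa, hTb, hTc, mem_union, mem_inter_iff, mem_compl_iff] at hω ⊢
      tauto
  linarith

/-- Three-blob count: on the good set, if `o` reaches relays `y`, `z` of two different non-observer blobs
then the observer's blob and both their blobs are counted: `m_{cls o} + m_{cls y} + m_{cls z} ≤ N`.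
[folklore] -/
theorem blobs_count_ge_three {b : ℕ} (A : Finset (Fin n)) (o : Fin n) (cls : Fin n → Fin b)
    (ω : BondConfig (Fin n))
    (hω : ∀ u ∈ insert o A, ∀ v ∈ insert o A, cls u = cls v → (openGraph ω).Reachable u v)
    {y z : Fin n} (hy : y ∈ A) (hz : z ∈ A) (hoy : (openGraph ω).Reachable o y)
    (hoz : (openGraph ω).Reachable o z) (hyo : cls y ≠ cls o) (hzo : cls z ≠ cls o)
    (hyz : cls y ≠ cls z) :
    (A.filter fun a => cls a = cls o).card + (A.filter fun a => cls a = cls y).card +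
        (A.filter fun a => cls a = cls z).card ≤
      (A.filter fun a => ω ∈ openConn o a).card := by
  rw [← Finset.card_union_of_disjoint
      (Finset.disjoint_filter.2 fun a _ h1 h2 => hyo (h2.symm.trans h1)),
    ← Finset.card_union_of_disjoint (Finset.disjoint_union_left.2
      ⟨Finset.disjoint_filter.2 fun a _ h1 h2 => hzo (h2.symm.trans h1),
       Finset.disjoint_filter.2 fun a _ h1 h2 => hyz (h1.symm.trans h2)⟩)]
  apply Finset.card_le_card
  intro a ha
  simp only [Finset.mem_union, Finset.mem_filter] at ha ⊢
  rcases ha with (⟨haA, hca⟩ | ⟨haA, hca⟩) | ⟨haA, hca⟩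
  · exact ⟨haA, hω o (Finset.mem_insert_self _ _) a (Finset.mem_insert_of_mem haA) hca.symm⟩
  · exact ⟨haA, hoy.trans
      (hω y (Finset.mem_insert_of_mem hy) a (Finset.mem_insert_of_mem haA) hca.symm)⟩
  · exact ⟨haA, hoz.trans
      (hω z (Finset.mem_insert_of_mem hz) a (Finset.mem_insert_of_mem haA) hca.symm)⟩

/-- Four-blob mass bound: if the labels `cls o, cls a, cls b, cls c` are pairwise distinct then every relay
carries one of them and `|A| ≤ m_{cls o} + m_{cls a} + m_{cls b} + m_{cls c}`. [folklore] -/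
theorem blobs_card_le_four (A : Finset (Fin n)) (o a b c : Fin n) (cls : Fin n → Fin 4)
    (hoa : cls o ≠ cls a) (hob : cls o ≠ cls b) (hoc : cls o ≠ cls c) (hab : cls a ≠ cls b)
    (hac : cls a ≠ cls c) (hbc : cls b ≠ cls c) :
    A.card ≤ (A.filter fun d => cls d = cls o).card + (A.filter fun d => cls d = cls a).card +
      (A.filter fun d => cls d = cls b).card + (A.filter fun d => cls d = cls c).card := by
  calc A.card ≤ ((((A.filter fun d => cls d = cls o) ∪ (A.filter fun d => cls d = cls a)) ∪
        (A.filter fun d => cls d = cls b)) ∪ (A.filter fun d => cls d = cls c)).card := by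
        apply Finset.card_le_card
        intro d hd
        simp only [Finset.mem_union, Finset.mem_filter]
        rcases fin4_exhaust hoa hob hoc hab hac hbc (cls d) with h | h | h | h
        · exact Or.inl (Or.inl (Or.inl ⟨hd, h⟩))
        · exact Or.inl (Or.inl (Or.inr ⟨hd, h⟩))
        · exact Or.inl (Or.inr ⟨hd, h⟩)
        · exact Or.inr ⟨hd, h⟩
    _ ≤ _ := (Finset.card_union_le _ _).trans (by
        gcongr
        exact (Finset.card_union_le _ _).trans (by gcongr; exact Finset.card_union_le _ _))

/-- **The one-cut bound for four blobs with constant `3/2`, unconditional.**  For every blob structure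
`cls : Fin n → Fin 4` on `insert o A` (same label ⇒ joined almost surely), every `|A|`, every weight and
every `t ≥ 0` bounding the pairwise disconnection probabilities among distinct relays:
`μ{1 ≤ N ∧ N < E N/2} ≤ (3/2)·t`.  Constant `1` holds in every sub-case except the residual regime
(observer blob with a relay, three light blobs), where the layer-cake bound gives `3/2`; the sharp constant
there is the open four-terminal inequality (R4a*) of `…OneCutFourBlobs.lean`.
[cite: VandenbergHaggstromKahn2005, Thm. 1.5 — via tripodExchange, for the constant-1 sub-cases] -/
theorem oneCut_of_fourBlobs_threeHalves :
    ∀ (n : ℕ) (w : Sym2 (Fin n) → unitInterval) (A : Finset (Fin n)) (o : Fin n) (t : ℝ)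
      (cls : Fin n → Fin 4),
      (∀ u ∈ insert o A, ∀ v ∈ insert o A, cls u = cls v →
        (Literature.Probability.LatticeModels.prodBernoulli w).real
          (Literature.Probability.Percolation.openConn u v)ᶜ = 0) →
      0 ≤ t →
      (∀ a ∈ A, ∀ a' ∈ A, a ≠ a' →
        (Literature.Probability.LatticeModels.prodBernoulli w).real
          (Literature.Probability.Percolation.openConn a a')ᶜ ≤ t) →
      (Literature.Probability.LatticeModels.prodBernoulli w).real
        {ω : Literature.Probability.Percolation.BondConfig (Fin n) |
          1 ≤ (A.filter fun a => ω ∈ Literature.Probability.Percolation.openConn o a).card ∧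
          ((A.filter fun a => ω ∈ Literature.Probability.Percolation.openConn o a).card : ℝ) <
            (∑ a ∈ A, (Literature.Probability.LatticeModels.prodBernoulli w).real
              (Literature.Probability.Percolation.openConn o a)) / 2} ≤ 3 / 2 * t := by
  intro n w A o t cls hcls ht hpair
  set μ := prodBernoulli w with hμ
  set EN := ∑ a ∈ A, μ.real (openConn o a) with hEN
  set m : Fin 4 → ℕ := fun i => (A.filter fun a => cls a = i).card with hm
  have ht' : t ≤ 3 / 2 * t := by linarith
  have hT : EN / 2 ≤ (A.card : ℝ) / 2 := by
    have := expectedCount_le_card w A o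
    linarith
  -- (1) an unused non-observer label: three blobs
  by_cases hdeg : ∃ i : Fin 4, i ≠ cls o ∧ ∀ a ∈ A, cls a ≠ i
  · obtain ⟨i, hi, hempty⟩ := hdeg
    exact (oneCut_of_fourBlobs_of_emptyLabel w A o t cls hcls i hi hempty ht hpair).trans ht'
  push Not at hdeg
  -- (2) observer-free
  by_cases hfree : ∀ a ∈ A, cls a ≠ cls o
  · exact (oneCut_of_fourBlobs_observerFree n w A o t cls hcls hfree ht hpair).trans ht'
  push Not at hfree
  obtain ⟨x₀, hx₀, hcx₀⟩ := hfree
  -- (3) a heavy blob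
  by_cases hheavy : ∃ y ∈ A, cls y ≠ cls o ∧
      EN / 2 ≤ ((A.filter fun a => cls a = cls o).card : ℝ) + ((A.filter fun a => cls a = cls y).card : ℝ)
  · obtain ⟨y, hy, hcy, hh⟩ := hheavy
    exact (oneCut_of_blobs_heavy w A o t cls hcls hx₀ hcx₀ hy hcy hh hpair).trans ht'
  push Not at hheavy
  -- (4) the residual regime: all three other blobs light; representatives `a, b, c`
  obtain ⟨j, k, l, hj, hk, hl, hjk, hjl, hkl⟩ : ∃ j k l : Fin 4, j ≠ cls o ∧ k ≠ cls o ∧ l ≠ cls o ∧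
      j ≠ k ∧ j ≠ l ∧ k ≠ l := by
    generalize cls o = i
    revert i
    decide
  obtain ⟨a, ha, hca⟩ := hdeg j hj
  obtain ⟨b, hb, hcb⟩ := hdeg k hk
  obtain ⟨c, hc, hcc⟩ := hdeg l hl
  have hao : cls a ≠ cls o := by rw [hca]; exact hj
  have hbo : cls b ≠ cls o := by rw [hcb]; exact hk
  have hco : cls c ≠ cls o := by rw [hcc]; exact hl
  have hcab : cls a ≠ cls b := by rw [hca, hcb]; exact hjk
  have hcac : cls a ≠ cls c := by rw [hca, hcc]; exact hjl
  have hcbc : cls b ≠ cls c := by rw [hcb, hcc]; exact hkl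
  have hxa : x₀ ≠ a := fun h => hao (by rw [← h, hcx₀])
  have hxb : x₀ ≠ b := fun h => hbo (by rw [← h, hcx₀])
  have hxc : x₀ ≠ c := fun h => hco (by rw [← h, hcx₀])
  -- every pair of other blobs is heavy (else the third blob alone would be heavy)
  have hpairs : ∀ y z u : Fin n, y ∈ A → z ∈ A → u ∈ A → cls y ≠ cls o → cls z ≠ cls o → cls u ≠ cls o →
      cls y ≠ cls z → cls y ≠ cls u → cls z ≠ cls u →
      EN / 2 ≤ (m (cls o) : ℝ) + (m (cls y) : ℝ) + (m (cls z) : ℝ) := by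
    intro y z u hy hz hu hyo hzo huo hyz hyu hzu
    by_contra hlt
    push Not at hlt
    have hcard := blobs_card_le_four A o y z u cls (Ne.symm hyo) (Ne.symm hzo) (Ne.symm huo) hyz hyu hzu
    have hcard' : (A.card : ℝ) ≤ (m (cls o) : ℝ) + (m (cls y) : ℝ) + (m (cls z) : ℝ) + (m (cls u) : ℝ) := by
      exact_mod_cast hcard
    have hu_light := hheavy u hu huo
    have hm0 : (0 : ℝ) ≤ (m (cls o) : ℝ) := Nat.cast_nonneg _
    have : (m (cls u) : ℝ) < EN / 2 := by
      have := hu_light; simp only [hm] at this ⊢; linarith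
    linarith
  -- the trap: `x₀` misses at least two of `a, b, c`
  set Da := ((openConn x₀ a)ᶜ : Set (BondConfig (Fin n))) with hDa
  set Db := ((openConn x₀ b)ᶜ : Set (BondConfig (Fin n))) with hDb
  set Dc := ((openConn x₀ c)ᶜ : Set (BondConfig (Fin n))) with hDc
  have hE : μ.real ((Da ∩ Db) ∪ (Da ∩ Dc) ∪ (Db ∩ Dc)) ≤ 3 / 2 * t := by
    have h2 := measureReal_twoOfThree_le w Da Db Dc
    have h_a := hpair x₀ hx₀ a ha hxa
    have h_b := hpair x₀ hx₀ b hb hxb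
    have h_c := hpair x₀ hx₀ c hc hxc
    simp only [hDa, hDb, hDc] at h2 ⊢
    linarith
  refine oneCut_of_blobs_trap w A o (3 / 2 * t) cls hcls _ ((Da ∩ Db) ∪ (Da ∩ Dc) ∪ (Db ∩ Dc))
    (fun ω hω => ?_) hE
  obtain ⟨⟨h1, hNlt⟩, hωG⟩ := hω
  -- on the good set `o ↔ x₀`, and `o` reaches at most one of `a, b, c`
  have hox : (openGraph ω).Reachable o x₀ :=
    hωG o (Finset.mem_insert_self _ _) x₀ (Finset.mem_insert_of_mem hx₀) hcx₀.symm
  have key : ∀ y z u : Fin n, y ∈ A → z ∈ A → u ∈ A → cls y ≠ cls o → cls z ≠ cls o → cls u ≠ cls o →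
      cls y ≠ cls z → cls y ≠ cls u → cls z ≠ cls u →
      (openGraph ω).Reachable o y → (openGraph ω).Reachable o z → False := by
    intro y z u hy hz hu hyo hzo huo hyz hyu hzu hoy hoz
    have hge := blobs_count_ge_three A o cls ω hωG hy hz hoy hoz hyo hzo hyz
    have hge' : (m (cls o) : ℝ) + (m (cls y) : ℝ) + (m (cls z) : ℝ) ≤
        ((A.filter fun d => ω ∈ openConn o d).card : ℝ) := by exact_mod_cast hge
    have := hpairs y z u hy hz hu hyo hzo huo hyz hyu hzu
    linarith
  have mem : ∀ x y : Fin n, ω ∈ (openConn x y : Set (BondConfig (Fin n))) ↔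
      (openGraph ω).Reachable x y := fun _ _ => Iff.rfl
  have cut_of : ∀ y : Fin n, ¬ (openGraph ω).Reachable o y → ¬ (openGraph ω).Reachable x₀ y :=
    fun y h hxy => h (hox.trans hxy)
  simp only [hDa, hDb, hDc, mem_union, mem_inter_iff, mem_compl_iff, mem]
  by_cases hA : (openGraph ω).Reachable o a
  · by_cases hB : (openGraph ω).Reachable o b
    · exact absurd (key a b c ha hb hc hao hbo hco hcab hcac hcbc hA hB) id
    · by_cases hC : (openGraph ω).Reachable o c
      · exact absurd (key a c b ha hc hb hao hco hbo hcac hcab (Ne.symm hcbc) hA hC) id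
      · exact Or.inr ⟨cut_of b hB, cut_of c hC⟩
  · by_cases hB : (openGraph ω).Reachable o b
    · by_cases hC : (openGraph ω).Reachable o c
      · exact absurd (key b c a hb hc ha hbo hco hao hcbc (Ne.symm hcab) (Ne.symm hcac) hB hC) id
      · exact Or.inl (Or.inr ⟨cut_of a hA, cut_of c hC⟩)
    · exact Or.inl (Or.inl ⟨cut_of a hA, cut_of b hB⟩)

end Summit.CriticalPhenomena.PercolationContinuityZ3.Theorems

end
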